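import Summits.QuantumAdvantage.QuantumAdvantage.Theorems.SosSandwichTransferPBWalkMachine
import Summits.QuantumAdvantage.QuantumAdvantage.Theorems.SosSandwichTransferPBDescent
import HarnessLib

/-!
# Crux `TransferPB` (stmt-QuantumAdvantage-15238, route SosSandwich), line `birth` — the reference transcript machine asks short queries

Query-LENGTH clause of the machine half (M_str) of stub `stub_pbOracleSimulation`, for the reference machine
`walkMachine Wf Df` (`Theorems/SosSandwichTransferPBWalkMachineDefs.lean`), for EVERY oracle (no consistency
needed — the clause of (M_str) quantifies over all oracles):

* `mem_queryList_bind`, `mem_queryList_filterComp/flatMapComp/forEach`, `mem_queryList_of_mem_queries` — where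
  the queries of a composite computation / of a fuelled transcript come from;
* `length_encPathS_le`, `length_le_of_shape` — a BLOCK/SINGLE/MEAN instance or `A`-query at a path with `≤ P`
  entries of strings shorter than `W` has length `≤ 2|x| + 2·P·(2W+4) + W + 50`;
* `queryShape_liveComp`, `queryShape_candsComp`, `queryShape_walkComp`, `queryShape_meansComp`,
  `eval_walkComp_paths` — every query of the machine has one of the four shapes at a path of `≤ D` short entries
  (picks are candidates, hence shorter than the width bound);
* **`length_le_of_mem_queries_walkMachine`** — every query of `walkMachine Wf Df` on `x`, within any fuel and
  for every oracle, has length `≤ 2|x| + 2·Df x·(2·Wf x + 4) + Wf x + 50`.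

Together with `run_walkMachine` (runs) and `queryCount_machineComp_le_of_consistent` (rounds) this leaves, of
(M_str), exactly `OracleAlg.IsPolyTime` of a machine with these runs. All proved; no named fact.
Source: S. Arora, B. Barak, Computational Complexity (CUP 2009), §3.4 (transcripts of oracle machines).
-/

-- D-0017: single-conjunct summit ⇒ the duplicate `QuantumAdvantage.QuantumAdvantage` is mandated.
set_option linter.dupNamespace false

noncomputable section

namespace Summit.QuantumAdvantage.QuantumAdvantage.Cruxes.TransferPB.Birth

open Finset Literature.Computability.Cryptography Literature.Computability.Complexity
  Literature.Computability.QuantumComplexity Literature.Computability.QuantumComplexity.ClassicalSimulation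

namespace SimTreePB

section QueryListLemmas

variable {α β γ : Type} (O : Oracle)

/-- Queries of a sequential composition come from one of the two parts. [folklore] -/
theorem mem_queryList_bind {c : OracleComp β} {f : β → OracleComp γ} {y : List Bool}
    (h : y ∈ OracleComp.queryList O (OracleComp.bind c f)) :
    y ∈ OracleComp.queryList O c ∨ y ∈ OracleComp.queryList O (f (OracleComp.eval O c)) := by
  induction c with
  | pure b => exact Or.inr h
  | query q k ih =>
    simp only [OracleComp.bind, OracleComp.queryList, List.mem_cons, OracleComp.eval] at h ⊢
    rcases h with h | h
    · exact Or.inl (Or.inl h)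
    · rcases ih (O q) h with h' | h'
      · exact Or.inl (Or.inr h')
      · exact Or.inr h'

/-- No query at a leaf. [folklore] -/
@[simp] theorem queryList_pure' (b : β) : OracleComp.queryList O (OracleComp.pure b : OracleComp β) = [] := rfl

/-- The query of `askG`. [folklore] -/
@[simp] theorem queryList_askG (v : List Bool) : OracleComp.queryList O (askG v) = [true :: v] := rfl

/-- The query of `askA`. [folklore] -/
@[simp] theorem queryList_askA (u : List Bool) : OracleComp.queryList O (askA u) = [false :: u] := rfl

/-- Queries of `filterComp` come from the tests. [folklore] -/
theorem mem_queryList_filterComp {p : α → OracleComp Bool} {l : List α} {y : List Bool}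
    (h : y ∈ OracleComp.queryList O (filterComp p l)) : ∃ a ∈ l, y ∈ OracleComp.queryList O (p a) := by
  induction l with
  | nil => simp [filterComp] at h
  | cons a l ih =>
    simp only [filterComp] at h
    rcases mem_queryList_bind O h with h | h
    · exact ⟨a, by simp, h⟩
    · rcases mem_queryList_bind O h with h | h
      · obtain ⟨a', ha', h'⟩ := ih h
        exact ⟨a', by simp [ha'], h'⟩
      · simp at h

/-- Queries of `flatMapComp` come from the parts. [folklore] -/
theorem mem_queryList_flatMapComp {f : α → OracleComp (List β)} {l : List α} {y : List Bool}
    (h : y ∈ OracleComp.queryList O (flatMapComp f l)) : ∃ a ∈ l, y ∈ OracleComp.queryList O (f a) := by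
  induction l with
  | nil => simp [flatMapComp] at h
  | cons a l ih =>
    simp only [flatMapComp] at h
    rcases mem_queryList_bind O h with h | h
    · exact ⟨a, by simp, h⟩
    · rcases mem_queryList_bind O h with h | h
      · obtain ⟨a', ha', h'⟩ := ih h
        exact ⟨a', by simp [ha'], h'⟩
      · simp at h

/-- Queries of `forEach` come from the parts. [folklore] -/
theorem mem_queryList_forEach {f : α → OracleComp β} {l : List α} {y : List Bool}
    (h : y ∈ OracleComp.queryList O (OracleComp.forEach f l)) : ∃ a ∈ l, y ∈ OracleComp.queryList O (f a) := by
  induction l with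
  | nil => simp [OracleComp.forEach] at h
  | cons a l ih =>
    simp only [OracleComp.forEach] at h
    rcases mem_queryList_bind O h with h | h
    · exact ⟨a, by simp, h⟩
    · rcases mem_queryList_bind O h with h | h
      · obtain ⟨a', ha', h'⟩ := ih h
        exact ⟨a', by simp [ha'], h'⟩
      · simp [OracleComp.queryList] at h

/-- The transcript of `toOracleAlg c` within any fuel is drawn from the query list. [folklore] -/
theorem mem_queryList_of_mem_queriesAux (M : OracleAlg β) (x : List Bool) :
    ∀ (c : OracleComp β) (pre : List (List Bool)),
      (∀ answers, M.step x (pre ++ answers) = OracleComp.toStep c answers) →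
        ∀ (n : ℕ) (y : List Bool), y ∈ M.queriesAux O x n pre → y ∈ OracleComp.queryList O c
  | _, _, _, 0, y, hy => by simp [OracleAlg.queriesAux] at hy
  | OracleComp.pure b, pre, hstep, n + 1, y, hy => by
    have hs : M.step x pre = Sum.inr b := by simpa [OracleComp.toStep] using hstep []
    simp [OracleAlg.queriesAux, hs] at hy
  | OracleComp.query q k, pre, hstep, n + 1, y, hy => by
    have hs : M.step x pre = Sum.inl q := by simpa [OracleComp.toStep] using hstep []
    simp only [OracleAlg.queriesAux, hs, List.mem_cons] at hy
    simp only [OracleComp.queryList, List.mem_cons]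
    rcases hy with hy | hy
    · exact Or.inl hy
    · refine Or.inr (mem_queryList_of_mem_queriesAux M x (k (O q)) (pre ++ [O q]) (fun answers => ?_) n y hy)
      rw [List.append_assoc, hstep]
      rfl

/-- The transcript of `toOracleAlg c` within any fuel is drawn from `queryList O (c x)`. [folklore] -/
theorem mem_queryList_of_mem_queries (c : List Bool → OracleComp β) (x : List Bool) (n : ℕ) {y : List Bool}
    (hy : y ∈ (OracleComp.toOracleAlg c).queries O n x) : y ∈ OracleComp.queryList O (c x) :=
  mem_queryList_of_mem_queriesAux O (OracleComp.toOracleAlg c) x (c x) [] (fun _ => rfl) n y hy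

end QueryListLemmas

section Lengths

variable (x : List Bool)

/-- Length of a serialised string path with short strings. [folklore] -/
theorem length_encPathS_le {W : ℕ} : ∀ π : List (List Bool × Bool), (∀ e ∈ π, e.1.length < W) →
    (encPathS π).length ≤ π.length * (2 * W + 4)
  | [], _ => by simp [encPathS]
  | e :: π, h => by
    have he := h e (by simp)
    have ih := length_encPathS_le (π := π) fun e' he' => h e' (by simp [he'])
    simp only [encPathS, length_boolPair, List.length_cons]
    nlinarith

/-- **Length of a query of one of the machine's four shapes** at a path with `≤ P` entries of strings shorter
than `W`: `≤ 2|x| + 2·P·(2W+4) + W + 50`. [folklore] -/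
theorem length_le_of_shape {π : List (List Bool × Bool)} {W P : ℕ} (hπ : ∀ e ∈ π, e.1.length < W)
    (hP : π.length ≤ P) {y : List Bool}
    (hy : (∃ v : List Bool, v.length ≤ W ∧ (y = true :: encBlockS x π v ∨ y = true :: encSingleS x π v)) ∨
      (∃ u : List Bool, u.length < W ∧ y = false :: u) ∨ (∃ j : ℕ, j ≤ 40 ∧ y = true :: encMeanS x π j)) :
    y.length ≤ 2 * x.length + 2 * P * (2 * W + 4) + W + 50 := by
  have hep := length_encPathS_le (W := W) π hπ
  have hPW : π.length * (2 * W + 4) ≤ P * (2 * W + 4) := Nat.mul_le_mul_right _ hP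
  rcases hy with ⟨v, hv, rfl | rfl⟩ | ⟨u, hu, rfl⟩ | ⟨j, hj, rfl⟩
  · simp only [List.length_cons, encBlockS, length_boolPair]; nlinarith
  · simp only [List.length_cons, encSingleS, length_boolPair]; nlinarith
  · simp only [List.length_cons]; nlinarith
  · simp only [List.length_cons, encMeanS, length_boolPair, List.length_replicate]; nlinarith

end Lengths

section Shapes

variable {x : List Bool} (O : Oracle)

/-- Queries of `liveComp … j` are BLOCK instances of strings of length `≤ j`. [folklore] -/
theorem queryShape_liveComp (π : List (List Bool × Bool)) :
    ∀ (j : ℕ) {y : List Bool}, y ∈ OracleComp.queryList O (liveComp x π j) →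
      ∃ v : List Bool, v.length ≤ j ∧ y = true :: encBlockS x π v
  | 0, y, hy => by
    simp only [liveComp] at hy
    rcases mem_queryList_bind O hy with hy | hy
    · simp only [queryList_askG, List.mem_singleton] at hy
      exact ⟨[], by simp, hy⟩
    · simp at hy
  | j + 1, y, hy => by
    simp only [liveComp] at hy
    rcases mem_queryList_bind O hy with hy | hy
    · obtain ⟨v, hv, rfl⟩ := queryShape_liveComp π j hy
      exact ⟨v, by omega, rfl⟩
    · obtain ⟨u, hu, hy⟩ := mem_queryList_flatMapComp O hy
      obtain ⟨v, hv, hy⟩ := mem_queryList_filterComp O hy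
      simp only [queryList_askG, List.mem_singleton] at hy
      -- `u` is a live string of level `j` (length `j`), `v` a child
      have hO : ∀ v : List Bool, Computability.decodeBool (O (true :: v)) =
          (fun v => Computability.decodeBool (O (true :: v))) v := fun _ => rfl
      rw [eval_liveComp hO π j] at hu
      have hlen := length_of_mem_liveLevel hu
      simp only [List.mem_cons, List.not_mem_nil, or_false] at hv
      refine ⟨v, ?_, hy⟩
      rcases hv with rfl | rfl <;> simp [hlen]

/-- Queries of `candsComp … W` are BLOCK/SINGLE instances of strings of length `≤ W`. [folklore] -/
theorem queryShape_candsComp (π : List (List Bool × Bool)) (W : ℕ) {y : List Bool}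
    (hy : y ∈ OracleComp.queryList O (candsComp x π W)) :
    ∃ v : List Bool, v.length ≤ W ∧ (y = true :: encBlockS x π v ∨ y = true :: encSingleS x π v) := by
  simp only [candsComp] at hy
  have hO : ∀ v : List Bool, Computability.decodeBool (O (true :: v)) =
      (fun v => Computability.decodeBool (O (true :: v))) v := fun _ => rfl
  rcases mem_queryList_bind O hy with hy | hy
  · obtain ⟨j, hj, hy⟩ := mem_queryList_flatMapComp O hy
    obtain ⟨v, hv, rfl⟩ := queryShape_liveComp O π j hy
    exact ⟨v, hv.trans (List.mem_range.1 hj).le, Or.inl rfl⟩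
  · obtain ⟨u, hu, hy⟩ := mem_queryList_filterComp O hy
    rcases mem_queryList_bind O hy with hy | hy
    · simp only [queryList_askG, List.mem_singleton] at hy
      rw [eval_flatMapComp] at hu
      obtain ⟨j, hj, hu⟩ := List.mem_flatMap.1 hu
      rw [eval_liveComp hO π j] at hu
      have hlen := length_of_mem_liveLevel hu
      exact ⟨u, by rw [hlen]; exact (List.mem_range.1 hj).le, Or.inr hy⟩
    · simp at hy

/-- A pick of the reference machine is a candidate, hence shorter than `W`. [folklore] -/
theorem length_lt_of_pick (π : List (List Bool × Bool)) (W : ℕ) {u : List Bool}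
    (hu : (OracleComp.eval O (candsComp x π W)).argmin strNum = some u) : u.length < W := by
  have hO : ∀ v : List Bool, Computability.decodeBool (O (true :: v)) =
      (fun v => Computability.decodeBool (O (true :: v))) v := fun _ => rfl
  rw [eval_candsComp hO] at hu
  exact (descentPick_some_spec (by unfold descentPick; exact hu)).1

/-- **Queries of the walk** from a path with `≤ P` short entries are shaped at some path with `≤ P + D` short
entries. [folklore] -/
theorem queryShape_walkComp (W : ℕ) :
    ∀ (D : ℕ) (π : List (List Bool × Bool)) (P : ℕ), (∀ e ∈ π, e.1.length < W) → π.length ≤ P →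
      ∀ {y : List Bool}, y ∈ OracleComp.queryList O (walkComp x W D π) →
        ∃ π' : List (List Bool × Bool), (∀ e ∈ π', e.1.length < W) ∧ π'.length ≤ P + D ∧
          ((∃ v : List Bool, v.length ≤ W ∧ (y = true :: encBlockS x π' v ∨ y = true :: encSingleS x π' v)) ∨
            (∃ u : List Bool, u.length < W ∧ y = false :: u) ∨ (∃ j : ℕ, j ≤ 40 ∧ y = true :: encMeanS x π' j))
  | 0, π, P, _, _, y, hy => by simp [walkComp] at hy
  | D + 1, π, P, hπ, hP, y, hy => by
    simp only [walkComp] at hy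
    rcases mem_queryList_bind O hy with hy | hy
    · obtain ⟨v, hv, hy⟩ := queryShape_candsComp O π W hy
      exact ⟨π, hπ, by omega, Or.inl ⟨v, hv, hy⟩⟩
    · cases hu : (OracleComp.eval O (candsComp x π W)).argmin strNum with
      | none => rw [hu] at hy; simp at hy
      | some u =>
        rw [hu] at hy
        have hul := length_lt_of_pick O π W hu
        rcases mem_queryList_bind O hy with hy | hy
        · simp only [queryList_askA, List.mem_singleton] at hy
          exact ⟨π, hπ, by omega, Or.inr (Or.inl ⟨u, hul, hy⟩)⟩
        · obtain ⟨π', hπ', hlen, hsh⟩ := queryShape_walkComp W D (π ++ [(u, OracleComp.eval O (askA u))]) (P + 1)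
            (fun e he => by
              rcases List.mem_append.1 he with he | he
              · exact hπ e he
              · simp only [List.mem_singleton] at he; subst he; exact hul)
            (by simp; omega) hy
          exact ⟨π', hπ', by omega, hsh⟩

/-- Queries of `meansComp` are MEAN instances with `j ≤ 40`. [folklore] -/
theorem queryShape_meansComp (π : List (List Bool × Bool)) {y : List Bool}
    (hy : y ∈ OracleComp.queryList O (meansComp x π)) : ∃ j : ℕ, j ≤ 40 ∧ y = true :: encMeanS x π j := by
  unfold meansComp at hy
  obtain ⟨j, hj, hy⟩ := mem_queryList_forEach O hy
  simp only [queryList_askG, List.mem_singleton] at hy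
  rw [Finset.mem_toList, Finset.mem_Icc] at hj
  exact ⟨j, hj.2, hy⟩

/-- **The walk's paths stay short**: from a path with `≤ P` entries of strings shorter than `W`, the final path
has `≤ P + D` such entries (every pick is a candidate, of length `< W`). [folklore] -/
theorem eval_walkComp_paths (W : ℕ) :
    ∀ (D : ℕ) (π : List (List Bool × Bool)) (P : ℕ), (∀ e ∈ π, e.1.length < W) → π.length ≤ P →
      (∀ e ∈ OracleComp.eval O (walkComp x W D π), e.1.length < W) ∧
        (OracleComp.eval O (walkComp x W D π)).length ≤ P + D
  | 0, π, P, hπ, hP => ⟨by simpa [walkComp] using hπ, by simp [walkComp]; omega⟩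
  | D + 1, π, P, hπ, hP => by
    simp only [walkComp, OracleComp.eval_bind]
    cases hu : (OracleComp.eval O (candsComp x π W)).argmin strNum with
    | none => exact ⟨by simpa using hπ, by simp; omega⟩
    | some u =>
      simp only [OracleComp.eval_bind]
      have hul := length_lt_of_pick O π W hu
      have h := eval_walkComp_paths W D (π ++ [(u, OracleComp.eval O (askA u))]) (P + 1)
        (fun e he => by
          rcases List.mem_append.1 he with he | he
          · exact hπ e he
          · simp only [List.mem_singleton] at he; subst he; exact hul)
        (by simp; omega)
      exact ⟨h.1, by omega⟩

/-- **Every query of the reference machine is short**: length `≤ 2|x| + 2·D·(2·W'+4) + W' + 50` with `W' = Wf x`,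
`D = Df x`, for EVERY oracle (no consistency needed). [folklore] -/
theorem length_le_of_mem_queryList_machineComp (Wf Df : List Bool → ℕ) (x : List Bool) {y : List Bool}
    (hy : y ∈ OracleComp.queryList O (machineComp Wf Df x)) :
    y.length ≤ 2 * x.length + 2 * Df x * (2 * Wf x + 4) + Wf x + 50 := by
  simp only [machineComp] at hy
  rcases mem_queryList_bind O hy with hy | hy
  · obtain ⟨π', hπ', hlen, hsh⟩ := queryShape_walkComp O (Wf x) (Df x) [] 0 (by simp) (by simp) hy
    exact length_le_of_shape x hπ' (by simpa using hlen) hsh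
  · rcases mem_queryList_bind O hy with hy | hy
    · obtain ⟨j, hj, rfl⟩ := queryShape_meansComp O _ hy
      obtain ⟨h1, h2⟩ := eval_walkComp_paths O (x := x) (Wf x) (Df x) [] 0 (by simp) (by simp)
      exact length_le_of_shape x h1 (by simpa using h2) (Or.inr (Or.inr ⟨j, hj, rfl⟩))
    · simp at hy

/-- **The query-length clause of (M_str) for the reference machine**: within any fuel and for EVERY oracle,
every query of `walkMachine Wf Df` on `x` has length `≤ 2|x| + 2·Df x·(2·Wf x + 4) + Wf x + 50`. [folklore] -/
theorem length_le_of_mem_queries_walkMachine (Wf Df : List Bool → ℕ) (O : Oracle) (n : ℕ) (x : List Bool)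
    {y : List Bool} (hy : y ∈ (walkMachine Wf Df).queries O n x) :
    y.length ≤ 2 * x.length + 2 * Df x * (2 * Wf x + 4) + Wf x + 50 :=
  length_le_of_mem_queryList_machineComp O Wf Df x (mem_queryList_of_mem_queries O (machineComp Wf Df) x n hy)

end Shapes

end SimTreePB

end Summit.QuantumAdvantage.QuantumAdvantage.Cruxes.TransferPB.Birth

end
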